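import Literature.MathematicalPhysics.QuantumFieldTheory.Balaban1983to89.B12Eq44Ball
import Literature.MathematicalPhysics.QuantumFieldTheory.Balaban1983to89.B12Eq45LocalisedBlocks
import Mathlib.Topology.Algebra.Module.FiniteDimension
import Mathlib.Analysis.Normed.Module.FiniteDimension

/-!
# Bałaban, *Renormalization group approach to lattice gauge field theories. I* (CMP 109, 1987) [Balaban1987RG1], (4.4)–(4.5)
# pp. 281–282: the (4.4)-normed configuration space `Cfg44` is COMPLETE (a Banach space), and (4.5) with the inner map
# `𝐇_j(□₀, ·)` valued in the CONCRETE carrier and every block hypothesis discharged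

HONEST FRAMING (cell `lit-balaban`, verbatim): statement-level skeleton of published theorems with citation tags; proofs where landed;
nothing here is a claim about the Yang–Mills mass gap.

PDF held: `paper:balaban1987-cmp109-rg-i-small-field` (journal page = PDF page + 248); pp. 281–282 [PDF 33–34] re-read by this seat in
the held text layer.  THE PRINT, p. 281: *«… Thus it is defined and analytic on the space of configurations 𝐀 satisfying max{|𝐀|_X,
|P₁(□₀)𝐀|_X, |∇^ξ𝐀|_X, |Δ^ξ𝐀|_X} < α₂. (4.4)»*; p. 282: *«Each term on the right-hand side of (4.3) can be estimated with the help of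
Cauchy formula … The norm in (4.4) of the expression ⟨δ^{n(p)}𝐇_j(□₀,0)/δB^{n(p)}, ⊗_{i∈N(p)} B_i⟩ can be estimated by B₃ Π_{i∈N(p)}|B_i| … and
if one of the functions B_i is localized outside the domain X, then we have the additional exponential factor exp(−δ₀dist^{(ξ)}(X,
supp B_i)). Using (4.3) and the last remarks we obtain (4.5)»*.

WHAT IS REPRODUCED (SKELETON rows **B12.Eq4.4** / **B12.Eq4.5**, display owner r09, fold owner r20; head of B12.Eq4.4 `proved p299445 +
p299941 + p300570 + p303766`, of B12.Eq4.5 `proved-existing + p304656 + p305228`).  Gen 7 of this seat built the (4.4)-NORMED carrier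
`B12Eq44Ball.Cfg44 π P ξ S` (the `𝔤ᶜ`-valued Landau-gauge configurations `S = landauSub 𝓜 R ξ` on the finite torus, normed by the (4.4)
functional `seminorm44`); gen 8 discharged the four block hypotheses of the (4.3) ⇒ (4.5) kernel for an inner map `𝐇 : W → E` valued in an
ABSTRACT COMPLETE `E` (`B12Eq45LocalisedBlocks.norm_iteratedFDeriv_comp_le_of_loc`, `[CompleteSpace E]` — the Cauchy estimates on
`y ↦ D𝐇(y)[B_i]` need a Banach target) and recorded the dead end «chart at 𝒴 := Cfg44 needs completeness of Cfg44 (closed 𝓜.gc)».  THIS FILE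
proves that completeness and performs the instantiation `E := Cfg44`:
* §1 the four letters of (4.4) are CONTINUOUS linear maps of the configuration for the sup norm (`continuous_gradL`, `continuous_siteLapL`,
  `continuous_divL`, `continuous_covDηL`, `continuous_p1L` — finite combinations of evaluations, unit conjugations `R(1)`, the given maps
  `π`, `P`); hence **`seminorm44_le_mul_norm`**: `max{|𝐀|,|∇^ξ𝐀|,|πΔ^ξ𝐀|,|πP₁𝐀|} ≤ C|𝐀|` on the finite torus (with `|𝐀| ≤ max{…}` of gen 7:
  the (4.4)-norm and the sup norm are EQUIVALENT there — print never distinguishes them topologically);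
* §2 **`antilipschitz_incl`**, **`isUniformEmbedding_incl`** (the inclusion `Cfg44 → (bonds → 𝔸)` is a uniform embedding onto `S`),
  `range_incl`, **`completeSpace_of_isClosed`** (`𝔸` complete, `π`, `P` continuous, `S` closed ⇒ `Cfg44 π P ξ S` complete),
  `isClosed_landauSub` (`𝔤ᶜ` closed, `R` continuous), **`completeSpace_landau`**, and the hypothesis-free
  **`completeSpace_of_finiteDimensional`** for finite-dimensional `𝔸` (print: `𝔸 = M_N(ℂ) ⊇ 𝔤ᶜ`, p. 262 — every linear map continuous,
  every subspace closed, `𝔸` complete);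
* §3 **`norm_iteratedFDeriv_E_sub310_one_comp_le_of_loc`** — (4.5) for the CONCRETE outer map `𝐀 ↦ E^{(j)}(X, exp iξ𝐀)` of (4.4)
  (`B12Eq44Ball.analyticOnNhd_E_sub310_one_ball`, gen 7) composed with an inner map `𝐇 : W → Cfg44 π P ξ (landauSub 𝓜 R ξ)` of Prop. 9 [15]
  shape (analytic on an open set containing a ball, bounded there, `𝐇(0) = 0`) and the (190)-shape first-order localisation bound — the
  gen-7 knitting theorem `B12Eq44Ball.norm_iteratedFDeriv_E_sub310_one_comp_le` with its block data `hv`/`hvloc`/`hH` REPLACED by those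
  printed inputs (gen 8's kernel at `E := Cfg44`, now licensed by §2).
MODELLING / HONEST SCOPE.  As `B12Eq44Ball` (finite torus; `R`, `P`, `π` ℂ-linear; `S` the Landau subspace).  NEW hypotheses, all
topological and all automatic for `𝔸 = M_N(ℂ)`: `Continuous π`, `Continuous P`, `Continuous R`, `IsClosed 𝔤ᶜ`, `CompleteSpace 𝔸` (§2), resp.
the instance `[CompleteSpace (Cfg44 …)]` (§3).  NOT here: (1.17)/Prop. 9 itself, (190), (4.2) (rows B12.Eq1.17, B11.SectG, B12.Eq4.2-4.3).
Mega-formalization `lit-balaban`, HOME `run/shared/lean/pub/lit-balaban/`, Phase-2 proof seat p05 gen 9 (unit `lit-balaban-p05`, free-target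
protocol G.5-34(d)).  Imports `…B12Eq44Ball` (gen 7), `…B12Eq45LocalisedBlocks` (gen 8), Mathlib finite-dimension modules BY NAME; modifies
nothing there; theorems only, no definition, no new named fact.
-/

noncomputable section

open Set Metric Filter Topology

namespace Literature.MathematicalPhysics.QuantumFieldTheory.Balaban1983to89.B12Eq44Complete

open Literature.MathematicalPhysics.QuantumFieldTheory.Balaban1983to89
open Literature.MathematicalPhysics.QuantumFieldTheory.Balaban1983to89.B9Eq39Adjoint
open Literature.MathematicalPhysics.QuantumFieldTheory.Balaban1983to89.B9TorusCalculus
open Literature.MathematicalPhysics.QuantumFieldTheory.Balaban1983to89.B9Eq352ScalarFluct (siteLap)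
open Literature.MathematicalPhysics.QuantumFieldTheory.Balaban1983to89.B9Eq3117Current (covDη covDη_apply divB_smul)
open Literature.MathematicalPhysics.QuantumFieldTheory.Balaban1983to89.B12RegularSpaces111
open Literature.MathematicalPhysics.QuantumFieldTheory.Balaban1983to89.B12Eq18Current
open Literature.MathematicalPhysics.QuantumFieldTheory.Balaban1983to89.B12Eq311CurrentExpansion
open Literature.MathematicalPhysics.QuantumFieldTheory.Balaban1983to89.B12Eq44Space
open Literature.MathematicalPhysics.QuantumFieldTheory.Balaban1983to89.B12Eq44Ball

variable {P : Params} {i : ℕ} {𝔸 : Type*} [NormedRing 𝔸] [NormedAlgebra ℂ 𝔸]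

/-! ## §1. The letters of (4.4) are continuous for the sup norm; the (4.4)-functional is dominated by the sup norm -/

section Letters

variable (ξ : ℝ)

/-- `𝐀 ↦ (∇^ξ_μ𝐀_ν)(x) = ξ⁻¹(𝐀_ν(x+e_μ) − 𝐀_ν(x))` is continuous (two evaluations). [cite: Balaban1987RG1, (1.12) p.262, (4.4) p.281] -/
theorem continuous_gradL (μ ν : Fin P.d) (x : Site P i) :
    Continuous fun A : PBond P i → 𝔸 => gradL (P := P) (i := i) ξ μ ν x A := by
  simp only [gradL_apply, grad]
  fun_prop

/-- `𝐀 ↦ (Δ^ξ𝐀_μ)(x)` (the flat covariant site Laplacian of a component: a finite sum of conjugated evaluations) is continuous.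
[cite: Balaban1987RG1, (4.4) p.281] -/
theorem continuous_siteLapL (b : PBond P i) : Continuous fun A : PBond P i → 𝔸 => siteLapL (P := P) (i := i) ξ b A := by
  simp only [siteLapL_apply, siteLap, covDstar, covD, R, dirForm]
  refine continuous_const.smul (continuous_finsetSum _ fun μ _ => ?_)
  fun_prop

/-- `𝐀 ↦ ξ⁻¹D^{ξ*}𝐀` (site divergence) is continuous into the site fields with the sup norm. [cite: Balaban1987RG1, (3.11)-(3.13) p.272] -/
theorem continuous_divL : Continuous fun A : PBond P i → 𝔸 => divL (P := P) (i := i) ξ A := by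
  simp only [divL_apply, divB, covDstar, R, dirForm]
  refine continuous_pi fun y => continuous_const.smul (continuous_finsetSum _ fun μ _ => ?_)
  fun_prop

/-- `λ ↦ (D^ξλ)_μ(x)` is continuous. [cite: Balaban1987RG1, (3.11)-(3.13) p.272] -/
theorem continuous_covDηL (μ : Fin P.d) (x : Site P i) : Continuous fun lam : Site P i → 𝔸 => covDηL (P := P) (i := i) ξ μ x lam := by
  simp only [covDηL_apply, covDη_apply, covD, R]
  fun_prop

/-- `𝐀 ↦ π(P₁𝐀)(b)` is continuous when `π` and `P` are (on `M_N(ℂ)`-valued fields every linear map is). [cite: Balaban1987RG1, (4.4) p.281] -/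
theorem continuous_p1L {π : 𝔸 →ₗ[ℂ] 𝔸} (hπ : Continuous π) {Pop : (Site P i → 𝔸) →ₗ[ℂ] (Site P i → 𝔸)} (hP : Continuous Pop)
    (b : PBond P i) : Continuous fun A : PBond P i → 𝔸 => p1L (P := P) (i := i) ξ π Pop b A := by
  have h : (fun A : PBond P i → 𝔸 => p1L (P := P) (i := i) ξ π Pop b A)
      = π ∘ (fun lam => covDηL (P := P) (i := i) ξ b.dir b.src lam) ∘ Pop ∘ fun A => divL (P := P) (i := i) ξ A := by
    funext A
    rfl
  rw [h]
  exact hπ.comp ((continuous_covDηL ξ b.dir b.src).comp (hP.comp (continuous_divL ξ)))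

/-- **The (4.4)-functional is dominated by the sup norm on the finite torus**: `max{|𝐀|, |∇^ξ𝐀|, |πΔ^ξ𝐀|, |πP₁𝐀|} ≤ C|𝐀|` for some
`C > 0` (depending on `ξ`, `π`, `P`, the torus), `π` and `P` continuous.  With `|𝐀| ≤ max{…}` (`B12Eq44Ball.norm_le_seminorm44`) the two
norms are equivalent. [cite: Balaban1987RG1, (4.4) p.281] -/
theorem seminorm44_le_mul_norm {π : 𝔸 →ₗ[ℂ] 𝔸} (hπ : Continuous π) {Pop : (Site P i → 𝔸) →ₗ[ℂ] (Site P i → 𝔸)}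
    (hP : Continuous Pop) :
    ∃ C : ℝ, 0 < C ∧ ∀ A : PBond P i → 𝔸, seminorm44 (P := P) (i := i) π Pop ξ A ≤ C * ‖A‖ := by
  classical
  let g : (Fin P.d × Fin P.d) × Site P i → ((PBond P i → 𝔸) →L[ℂ] 𝔸) := fun q =>
    ⟨gradL ξ q.1.1 q.1.2 q.2, continuous_gradL ξ q.1.1 q.1.2 q.2⟩
  let l : PBond P i → ((PBond P i → 𝔸) →L[ℂ] 𝔸) := fun b =>
    ⟨π ∘ₗ siteLapL ξ b, hπ.comp (continuous_siteLapL ξ b)⟩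
  let p : PBond P i → ((PBond P i → 𝔸) →L[ℂ] 𝔸) := fun b => ⟨p1L ξ π Pop b, continuous_p1L ξ hπ hP b⟩
  refine ⟨1 + ∑ q, ‖g q‖ + ∑ b, ‖l b‖ + ∑ b, ‖p b‖, by positivity, fun A => ?_⟩
  have hA : 0 ≤ ‖A‖ := norm_nonneg A
  have hCg : ∀ q, ‖g q‖ ≤ 1 + ∑ q, ‖g q‖ + ∑ b, ‖l b‖ + ∑ b, ‖p b‖ := fun q => by
    have h1 : ‖g q‖ ≤ ∑ q, ‖g q‖ := Finset.single_le_sum (fun q _ => norm_nonneg (g q)) (Finset.mem_univ q)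
    have h2 : 0 ≤ ∑ b, ‖l b‖ := Finset.sum_nonneg fun b _ => norm_nonneg (l b)
    have h3 : 0 ≤ ∑ b, ‖p b‖ := Finset.sum_nonneg fun b _ => norm_nonneg (p b)
    linarith
  have hCl : ∀ b, ‖l b‖ ≤ 1 + ∑ q, ‖g q‖ + ∑ b, ‖l b‖ + ∑ b, ‖p b‖ := fun b => by
    have h1 : ‖l b‖ ≤ ∑ b, ‖l b‖ := Finset.single_le_sum (fun b _ => norm_nonneg (l b)) (Finset.mem_univ b)
    have h2 : 0 ≤ ∑ q, ‖g q‖ := Finset.sum_nonneg fun q _ => norm_nonneg (g q)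
    have h3 : 0 ≤ ∑ b, ‖p b‖ := Finset.sum_nonneg fun b _ => norm_nonneg (p b)
    linarith
  have hCp : ∀ b, ‖p b‖ ≤ 1 + ∑ q, ‖g q‖ + ∑ b, ‖l b‖ + ∑ b, ‖p b‖ := fun b => by
    have h1 : ‖p b‖ ≤ ∑ b, ‖p b‖ := Finset.single_le_sum (fun b _ => norm_nonneg (p b)) (Finset.mem_univ b)
    have h2 : 0 ≤ ∑ q, ‖g q‖ := Finset.sum_nonneg fun q _ => norm_nonneg (g q)
    have h3 : 0 ≤ ∑ b, ‖l b‖ := Finset.sum_nonneg fun b _ => norm_nonneg (l b)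
    linarith
  have hC1 : (1 : ℝ) ≤ 1 + ∑ q, ‖g q‖ + ∑ b, ‖l b‖ + ∑ b, ‖p b‖ := by
    have h2 : 0 ≤ ∑ q, ‖g q‖ := Finset.sum_nonneg fun q _ => norm_nonneg (g q)
    have h3 : 0 ≤ ∑ b, ‖l b‖ := Finset.sum_nonneg fun b _ => norm_nonneg (l b)
    have h4 : 0 ≤ ∑ b, ‖p b‖ := Finset.sum_nonneg fun b _ => norm_nonneg (p b)
    linarith
  have hC0 : 0 ≤ (1 + ∑ q, ‖g q‖ + ∑ b, ‖l b‖ + ∑ b, ‖p b‖) * ‖A‖ := mul_nonneg (zero_le_one.trans hC1) hA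
  simp only [seminorm44, Seminorm.sup_apply]
  refine sup_le (sup_le (sup_le ?_ ?_) ?_) ?_
  · rw [coe_normSeminorm]
    calc ‖A‖ = 1 * ‖A‖ := (one_mul _).symm
      _ ≤ _ := mul_le_mul_of_nonneg_right hC1 hA
  · refine Seminorm.finset_sup_apply_le hC0 fun q _ => ?_
    rw [Seminorm.comp_apply, coe_normSeminorm]
    calc ‖gradL ξ q.1.1 q.1.2 q.2 A‖ = ‖g q A‖ := rfl
      _ ≤ ‖g q‖ * ‖A‖ := (g q).le_opNorm A
      _ ≤ _ := mul_le_mul_of_nonneg_right (hCg q) hA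
  · refine Seminorm.finset_sup_apply_le hC0 fun b _ => ?_
    rw [Seminorm.comp_apply, coe_normSeminorm]
    calc ‖(π ∘ₗ siteLapL ξ b) A‖ = ‖l b A‖ := rfl
      _ ≤ ‖l b‖ * ‖A‖ := (l b).le_opNorm A
      _ ≤ _ := mul_le_mul_of_nonneg_right (hCl b) hA
  · refine Seminorm.finset_sup_apply_le hC0 fun b _ => ?_
    rw [Seminorm.comp_apply, coe_normSeminorm]
    calc ‖p1L ξ π Pop b A‖ = ‖p b A‖ := rfl
      _ ≤ ‖p b‖ * ‖A‖ := (p b).le_opNorm A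
      _ ≤ _ := mul_le_mul_of_nonneg_right (hCp b) hA

end Letters

/-! ## §2. The (4.4)-normed space is complete -/

section Complete

variable {π : 𝔸 →ₗ[ℂ] 𝔸} {Pop : (Site P i → 𝔸) →ₗ[ℂ] (Site P i → 𝔸)} (ξ : ℝ) {S : Submodule ℂ (PBond P i → 𝔸)}

/-- **The inclusion `Cfg44 → (bonds → 𝔸)` is antilipschitz** (the (4.4)-norm is at most `C` times the sup norm), `π`, `P` continuous.
[cite: Balaban1987RG1, (4.4) p.281] -/
theorem antilipschitz_incl (hπ : Continuous π) (hP : Continuous Pop) :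
    ∃ K, AntilipschitzWith K (Cfg44.incl (P := P) (i := i) π Pop ξ S) := by
  obtain ⟨C, hC, h⟩ := seminorm44_le_mul_norm (P := P) (i := i) ξ hπ hP
  refine ⟨Real.toNNReal C, AntilipschitzWith.of_le_mul_dist fun w w' => ?_⟩
  rw [Real.coe_toNNReal _ hC.le, dist_eq_norm, dist_eq_norm, ← map_sub, Cfg44.incl_apply, Cfg44.norm_def]
  exact h _

/-- The inclusion is a UNIFORM EMBEDDING (antilipschitz and uniformly continuous). [cite: Balaban1987RG1, (4.4) p.281] -/
theorem isUniformEmbedding_incl (hπ : Continuous π) (hP : Continuous Pop) :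
    IsUniformEmbedding (Cfg44.incl (P := P) (i := i) π Pop ξ S) := by
  obtain ⟨K, hK⟩ := antilipschitz_incl (P := P) (i := i) (S := S) ξ hπ hP
  exact hK.isUniformEmbedding (Cfg44.incl π Pop ξ S).uniformContinuous

/-- The range of the inclusion is the subspace `S`. [cite: Balaban1987RG1, (4.4) p.281] -/
theorem range_incl : Set.range (Cfg44.incl (P := P) (i := i) π Pop ξ S) = (S : Set (PBond P i → 𝔸)) := by
  ext A
  constructor
  · rintro ⟨w, rfl⟩
    exact w.val_mem
  · intro hA
    exact ⟨Cfg44.mk A hA, rfl⟩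

/-- **`Cfg44 π P ξ S` IS COMPLETE** when `𝔸` is complete, `π`, `P` are continuous and `S` is closed (for the sup norm): the (4.4)-normed
configuration space of (4.3)–(4.5) is a complex BANACH space, as the Cauchy estimates of p. 282 require. [cite: Balaban1987RG1, (4.4) p.281] -/
theorem completeSpace_of_isClosed [CompleteSpace 𝔸] (hπ : Continuous π) (hP : Continuous Pop)
    (hS : IsClosed ((S : Submodule ℂ (PBond P i → 𝔸)) : Set (PBond P i → 𝔸))) :
    CompleteSpace (Cfg44 π Pop ξ S) := by
  rw [completeSpace_iff_isComplete_range (isUniformEmbedding_incl (P := P) (i := i) (S := S) ξ hπ hP).isUniformInducing,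
    range_incl]
  exact hS.isComplete

/-- **The Landau subspace `{𝐀 : 𝐀(b) ∈ 𝔤ᶜ ∀ b, R(ξ⁻¹D^{ξ*}𝐀) = 0}` is closed** when `𝔤ᶜ ⊂ 𝔸` is closed and `R` is continuous.
[cite: Balaban1987RG1, p.272, (4.4) p.281] -/
theorem isClosed_landauSub (𝓜 : Model 𝔸) {Rop : (Site P i → 𝔸) →ₗ[ℂ] (Site P i → 𝔸)} (hR : Continuous Rop)
    (hgc : IsClosed ((𝓜.gc : Submodule ℂ 𝔸) : Set 𝔸)) :
    IsClosed ((landauSub (P := P) (i := i) 𝓜 Rop ξ : Submodule ℂ (PBond P i → 𝔸)) : Set (PBond P i → 𝔸)) := by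
  have hset : ((landauSub (P := P) (i := i) 𝓜 Rop ξ : Submodule ℂ (PBond P i → 𝔸)) : Set (PBond P i → 𝔸))
      = (⋂ b : PBond P i, (fun A : PBond P i → 𝔸 => A b) ⁻¹' ((𝓜.gc : Submodule ℂ 𝔸) : Set 𝔸)) ∩
          {A : PBond P i → 𝔸 | Rop (divL (P := P) (i := i) ξ A) = 0} := by
    ext A
    simp only [SetLike.mem_coe, mem_landauSub_iff, Set.mem_inter_iff, Set.mem_iInter, Set.mem_preimage, Set.mem_setOf_eq,
      divL_apply]
  rw [hset]
  refine IsClosed.inter (isClosed_iInter fun b => hgc.preimage (continuous_apply b)) ?_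
  exact isClosed_eq (hR.comp (continuous_divL (P := P) (i := i) ξ)) continuous_const

/-- **The carrier of record `Cfg44 π P ξ (landauSub 𝓜 R ξ)` of rows B12.Eq4.4/4.5 is complete** (`𝔸` complete, `π`, `P`, `R` continuous,
`𝔤ᶜ` closed). [cite: Balaban1987RG1, (4.4) p.281] -/
theorem completeSpace_landau [CompleteSpace 𝔸] (𝓜 : Model 𝔸) {Rop : (Site P i → 𝔸) →ₗ[ℂ] (Site P i → 𝔸)}
    (hπ : Continuous π) (hP : Continuous Pop) (hR : Continuous Rop) (hgc : IsClosed ((𝓜.gc : Submodule ℂ 𝔸) : Set 𝔸)) :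
    CompleteSpace (Cfg44 π Pop ξ (landauSub (P := P) (i := i) 𝓜 Rop ξ)) :=
  completeSpace_of_isClosed (P := P) (i := i) ξ hπ hP (isClosed_landauSub (P := P) (i := i) ξ 𝓜 hR hgc)

/-- **For finite-dimensional `𝔸`** (print: `𝔸 = M_N(ℂ) ⊇ 𝔤ᶜ`, p. 262) NO hypothesis remains: every ℂ-linear map is continuous, every subspace
is closed and `𝔸` is complete — the (4.4)-normed Landau configuration space is a Banach space (stated as a theorem; use `haveI`).
[cite: Balaban1987RG1, (4.4) p.281, (1.10) p.262] -/
theorem completeSpace_of_finiteDimensional [FiniteDimensional ℂ 𝔸] (𝓜 : Model 𝔸) (π : 𝔸 →ₗ[ℂ] 𝔸)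
    (Pop Rop : (Site P i → 𝔸) →ₗ[ℂ] (Site P i → 𝔸)) (ξ : ℝ) :
    CompleteSpace (Cfg44 π Pop ξ (landauSub (P := P) (i := i) 𝓜 Rop ξ)) := by
  haveI : CompleteSpace 𝔸 := FiniteDimensional.complete ℂ 𝔸
  exact completeSpace_landau (P := P) (i := i) ξ 𝓜 π.continuous_of_finiteDimensional Pop.continuous_of_finiteDimensional
    Rop.continuous_of_finiteDimensional (Submodule.closed_of_finiteDimensional _)

end Complete

/-! ## §3. (4.5) with the inner map valued in the concrete (4.4)-carrier and every block hypothesis discharged -/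

section Ineq45

variable [CompleteSpace 𝔸] [NormOneClass 𝔸]
variable {V : Type*} [NormedAddCommGroup V] [NormedSpace ℂ V] [CompleteSpace V]
  {W : Type*} [NormedAddCommGroup W] [NormedSpace ℂ W]

/-- **(4.5) on the concrete carriers of (4.4), block hypotheses DISCHARGED.**  Outer map: `𝐀 ↦ E^{(j)}(X, exp iξ𝐀)` analytic on the open
`α₂`-ball of the (4.4)-normed Landau space (`B12Eq44Ball.analyticOnNhd_E_sub310_one_ball`, from (1.18)'s analyticity of `E^{(j)}` on
`U^c_j(X,α₀,α₁)` + the membership (i)–(iv)), with sup `S` there ((1.18): `E₀e^{−κd_j(X)}`).  Inner map `𝐇 : W → Cfg44 …` of Prop. 9 [15] shape: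
analytic on an open `UW ⊇ ball 0 a`, `‖𝐇‖ ≤ SH` on the ball, `𝐇(0) = 0`; the (190)-shape FIRST-ORDER localisation bound
`‖D𝐇(y)[B_i]‖ ≤ W₀K|B_i|` on the ball for the arguments `B_i` localized outside `X` (`out i`, at least one).  Conclusion: pv12's (4.5) bound
for `Dⁿ(E ∘ 𝐇)(0)[B₁,…,B_n]` with `B₃ := max{SH, K}·max{1, 2n/a}ⁿ` — gen 8's `B12Eq45LocalisedBlocks.norm_iteratedFDeriv_comp_le_of_loc` AT
`E := Cfg44 π P ξ (landauSub 𝓜 R ξ)`, whose completeness (§2; automatic for finite-dimensional `𝔸`) is the instance hypothesis.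
[cite: Balaban1987RG1, (4.4)–(4.5) pp.281–282; (1.18) p.263] -/
theorem norm_iteratedFDeriv_E_sub310_one_comp_le_of_loc (𝓜 : Model 𝔸) {F : Frame P i 𝔸} {c : StepConsts} {π : 𝔸 →ₗ[ℂ] 𝔸}
    {Rop Pop : (Site P i → 𝔸) →ₗ[ℂ] (Site P i → 𝔸)} [CompleteSpace (Cfg44 π Pop c.ξ (landauSub (P := P) (i := i) 𝓜 Rop c.ξ))]
    {α₀ α₁ α₂ Cπ : ℝ}
    (hξ : 0 < c.ξ) (hξ1 : c.ξ ≤ 1) (hcB : 0 < c.cB) (hα₀ : 0 < α₀) (hα₀1 : α₀ ≤ 1) (hα₂ : 0 < α₂)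
    (hα₂q : α₂ ≤ 1 / 4) (hα₂α₁ : α₂ ≤ α₁) (h8 : 8 * α₂ < α₀) (hCπ : 0 ≤ Cπ) (hπn : ∀ X, ‖π X‖ ≤ Cπ * ‖X‖)
    (hπgc : ∀ X, π X ∈ 𝓜.gc) (hgcAd : ∀ g ∈ 𝓜.Gc, ∀ X ∈ 𝓜.gc, R g X ∈ 𝓜.gc) (heGc : ∀ a ∈ 𝓜.gc, expI c.ξ a ∈ 𝓜.Gc)
    (hRP : ∀ f : Site P i → 𝔸, Rop f + Pop f = f)
    (hres : (2 + (P.d - 1) * (Cπ * (C311 1 + 2 * 1 ^ 14))) * α₂ ≤ α₀)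
    (E : (PBond P i → 𝔸) × (PBond P i → 𝔸) → V)
    (hE : ∀ Φ ∈ space' 𝓜 F c α₀ α₁, AnalyticAt ℂ E ((fun b => (Φ.U b : 𝔸)), Φ.J))
    (hIV₁ : CondIV F.bg F.X₂ c α₀ (1 : PBond P i → 𝔸ˣ))
    (hIV : ∀ A ∈ space44 π Pop c.ξ α₂, CondIV F.bg F.X₂ c α₀ (sub310 c.ξ A (1 : PBond P i → 𝔸ˣ)))
    {S : ℝ}
    (hS : ∀ w ∈ Metric.ball (0 : Cfg44 π Pop c.ξ (landauSub 𝓜 Rop c.ξ)) α₂,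
      ‖E ((fun b => ((ofBackground π c.ξ (sub310 c.ξ w.val (1 : PBond P i → 𝔸ˣ))).U b : 𝔸)),
        (ofBackground π c.ξ (sub310 c.ξ w.val (1 : PBond P i → 𝔸ˣ))).J)‖ ≤ S)
    {UW : Set W} (hUW : IsOpen UW) {a SH : ℝ} (ha : 0 < a) (hball : ball (0 : W) a ⊆ UW)
    {H : W → Cfg44 π Pop c.ξ (landauSub 𝓜 Rop c.ξ)} (hH : AnalyticOnNhd ℂ H UW) (hSH : ∀ y ∈ ball (0 : W) a, ‖H y‖ ≤ SH)
    (hH0 : H 0 = 0) {n : ℕ} (B : Fin n → W) {W₀ K : ℝ} (hW0 : 0 ≤ W₀) (hW1 : W₀ ≤ 1) (hK : 0 ≤ K)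
    (out : Fin n → Prop) (i₀ : Fin n) (hi₀ : out i₀)
    (hloc : ∀ j, out j → ∀ y ∈ ball (0 : W) a, ‖fderiv ℂ H y (B j)‖ ≤ W₀ * (K * ‖B j‖))
    (hB : α₂ ≤ 2 * (max SH K * (max 1 (2 * (n : ℝ) / a)) ^ n)) :
    ‖iteratedFDeriv ℂ n (((fun A : PBond P i → 𝔸 =>
      E ((fun b => ((ofBackground π c.ξ (sub310 c.ξ A (1 : PBond P i → 𝔸ˣ))).U b : 𝔸)),
        (ofBackground π c.ξ (sub310 c.ξ A (1 : PBond P i → 𝔸ˣ))).J)) ∘ Cfg44.incl π Pop c.ξ (landauSub 𝓜 Rop c.ξ)) ∘ H) 0 B‖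
      ≤ (2 * (n : ℝ) ^ 2 * (max SH K * (max 1 (2 * (n : ℝ) / a)) ^ n) / α₂) ^ n * S * W₀ * ∏ j, ‖B j‖ :=
  B12Eq45LocalisedBlocks.norm_iteratedFDeriv_comp_le_of_loc Metric.isOpen_ball hα₂ subset_rfl
    (analyticOnNhd_E_sub310_one_ball 𝓜 hξ hξ1 hcB hα₀ hα₀1 hα₂ hα₂q hα₂α₁ h8 hCπ hπn hπgc hgcAd heGc hRP hres E hE hIV₁ hIV)
    (fun w hw => hS w hw) hUW ha hball hH hSH hH0 B hW0 hW1 hK out i₀ hi₀ hloc hB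

end Ineq45

end Literature.MathematicalPhysics.QuantumFieldTheory.Balaban1983to89.B12Eq44Complete

end
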